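import Summits.MatrixMultiplication.OmegaCensus.SmallFormats.GF2ForcedProduct
import HarnessLib

/-!
# ω-census family (a), GF(2) rank floors: residual obligations by separating functionals (no `α`-enumeration)

Cell `pub-omega` (unit `pub-omega-lit`, gen 4), topic `Summits/MatrixMultiplication/OmegaCensus` (sub-folder
`SmallFormats`). Framing (verbatim): lottery ticket; floor = certified bounds/negative ranges. HONEST FRAMING:
replay infrastructure; nothing here is progress on `ω`. PROVED, no facts.

The forced-product obligation `ResidualsOK` (`GF2ForcedProduct.lean`) asks that for EVERY coefficient pattern
`α ∈ 𝔽₂^Q` the selected residual rows `v_i(α) ∈ 𝔽₂^C` be independent. The rows are affine in `α`: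
`v_i(α) = B_i + ∑_q α_q C_{q,i}` (`resRow1_eq_affine`). For a fixed nonzero `g ∈ 𝔽₂^r` the patterns `α` with
`∑_i g_i v_i(α) = 0` form an affine subspace, which is EMPTY as soon as some functional `y` has `y·(gB) = 1` and
`y·(gC_q) = 0` for all `q`; so a table of such `y`, one per nonzero `g` (found by linear algebra outside Lean and
merely CHECKED here, `funcCertB`), proves independence for all `2^Q` patterns at once
(`residualsOK_of_funcCert`, using the completeness half `indepB_of_linearIndependent` of the executable check).
-/

namespace Summit.MatrixMultiplication.OmegaCensus.GF2RankLB

open Module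

/-! ## xor-folds of numbers and parity functionals -/

/-- `xorFold f s = f 0 ^^^ … ^^^ f (s-1)`. -/
def xorFold (f : ℕ → ℕ) : ℕ → ℕ
  | 0 => 0
  | s + 1 => xorFold f s ^^^ f s

/-- Bits of an xor-fold. -/
theorem testBit_xorFold (f : ℕ → ℕ) (p : ℕ) : ∀ s, (xorFold f s).testBit p = bxor (fun j => (f j).testBit p) s
  | 0 => by simp [xorFold, bxor]
  | s + 1 => by rw [xorFold, Nat.testBit_xor, testBit_xorFold f p s]; rfl

/-- `bxor` is additive. -/
theorem bxor_xor (f g : ℕ → Bool) : ∀ s, bxor (fun j => xor (f j) (g j)) s = xor (bxor f s) (bxor g s)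
  | 0 => by simp [bxor]
  | s + 1 => by
    simp only [bxor, bxor_xor f g s]
    cases bxor f s <;> cases bxor g s <;> cases f s <;> cases g s <;> rfl

/-- `bxor` of `false`s. -/
theorem bxor_false' : ∀ s, bxor (fun _ => false) s = false
  | 0 => rfl
  | s + 1 => by rw [bxor, bxor_false' s]; rfl

/-- `bxor` depends only on the values below `s`. -/
theorem bxor_congr {f g : ℕ → Bool} : ∀ {s}, (∀ j < s, f j = g j) → bxor f s = bxor g s
  | 0, _ => rfl
  | s + 1, h => by
    rw [bxor, bxor, bxor_congr (s := s) fun j hj => h j (Nat.lt_succ_of_lt hj), h s (Nat.lt_succ_self s)]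

/-- Exchange of two `bxor`s. -/
theorem bxor_comm2 (f : ℕ → ℕ → Bool) (Q : ℕ) : ∀ s,
    bxor (fun j => bxor (fun q => f q j) Q) s = bxor (fun q => bxor (fun j => f q j) s) Q
  | 0 => by simp only [bxor]; exact (bxor_false' Q).symm
  | s + 1 => by
    rw [bxor, bxor_comm2 f Q s, ← bxor_xor]
    rfl

/-- A `bxor` against an indicator picks one term. -/
theorem bxor_indicator (a : ℕ → Bool) (qj : ℕ) : ∀ Q,
    bxor (fun q => a q && (qj == q)) Q = (decide (qj < Q) && a qj)
  | 0 => by simp [bxor]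
  | Q + 1 => by
    rw [bxor, bxor_indicator a qj Q]
    by_cases h : qj = Q
    · subst h; simp
    · have h1 : (qj == Q) = false := beq_eq_false_iff_ne.2 h
      rw [h1, Bool.and_false, Bool.xor_false]
      by_cases h2 : qj < Q
      · simp [h2, Nat.lt_succ_of_lt h2]
      · have h3 : ¬ qj < Q + 1 := by omega
        simp [h2, h3]

/-- `bdot` is additive in the second argument. -/
theorem bdot_xor (C y a b : ℕ) : bdot C y (a ^^^ b) = xor (bdot C y a) (bdot C y b) := by
  simp only [bdot, ← bxor_xor]
  congr 1
  funext p
  rw [Nat.testBit_xor]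
  cases y.testBit p <;> cases a.testBit p <;> cases b.testBit p <;> rfl

/-- `bdot` against `0`. -/
theorem bdot_zero (C y : ℕ) : bdot C y 0 = false := by
  simp only [bdot, Nat.zero_testBit, Bool.and_false]
  exact bxor_false' C

/-- `bdot` against an xor-fold. -/
theorem bdot_xorFold (C y : ℕ) (f : ℕ → ℕ) : ∀ s, bdot C y (xorFold f s) = bxor (fun j => bdot C y (f j)) s
  | 0 => by simp [xorFold, bxor, bdot_zero]
  | s + 1 => by rw [xorFold, bdot_xor, bdot_xorFold C y f s]; rfl

/-- xor-folds of numbers below `2 ^ C` stay below `2 ^ C`. -/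
theorem xorFold_lt {C : ℕ} (f : ℕ → ℕ) (hf : ∀ j, f j < 2 ^ C) : ∀ s, xorFold f s < 2 ^ C
  | 0 => by simp [xorFold]
  | s + 1 => by rw [xorFold]; exact Nat.xor_lt_two_pow (xorFold_lt f hf s) (hf s)

/-! ## Completeness of `indepB` -/

/-- Every subset xor of the rows lies in their span. -/
theorem vecOf_allXors_mem_span (N : ℕ) : ∀ (L : List ℕ), ∀ s ∈ allXors L,
    vecOf N s ∈ Submodule.span (ZMod 2) (Set.range (rowVec N L))
  | [], s, hs => by
    simp only [allXors, List.mem_singleton] at hs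
    subst hs; rw [vecOf_zero]; exact Submodule.zero_mem _
  | a :: L, s, hs => by
    rw [range_rowVec_cons]
    simp only [allXors, List.mem_append, List.mem_map] at hs
    rcases hs with hs | ⟨s', hs', rfl⟩
    · exact Submodule.span_mono (Set.subset_insert _ _) (vecOf_allXors_mem_span N L s hs)
    · rw [vecOf_xor]
      exact Submodule.add_mem _ (Submodule.subset_span (Set.mem_insert _ _))
        (Submodule.span_mono (Set.subset_insert _ _) (vecOf_allXors_mem_span N L s' hs'))

/-- Completeness of `indepB`: independent bit rows pass the check. -/
theorem indepB_of_linearIndependent (N : ℕ) : ∀ (L : List ℕ),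
    LinearIndependent (ZMod 2) (rowVec N L) → indepB L = true
  | [], _ => rfl
  | a :: L, h => by
    have e : rowVec N (a :: L) = Fin.cons (vecOf N a) (rowVec N L) := by
      funext i; refine Fin.cases ?_ (fun j => ?_) i <;> simp [rowVec]
    rw [e] at h
    obtain ⟨h1, h2⟩ := linearIndependent_finCons.mp h
    simp only [indepB, Bool.and_eq_true, List.all_eq_true]
    refine ⟨indepB_of_linearIndependent N L h1, fun s hs => ?_⟩
    have hne : s ≠ a := fun hsa => h2 (hsa ▸ vecOf_allXors_mem_span N L s hs)
    simpa using hne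

/-- `indepB` of `List.ofFn` from independence of the function family. -/
theorem indepB_ofFn_of_linearIndependent {r N : ℕ} (rows : Fin r → ℕ)
    (h : LinearIndependent (ZMod 2) (fun i => vecOf N (rows i))) : indepB (List.ofFn rows) = true := by
  apply indepB_of_linearIndependent N
  let e : Fin (List.ofFn rows).length ≃ Fin r := finCongr (List.length_ofFn)
  have h2 : rowVec N (List.ofFn rows) = (fun i => vecOf N (rows i)) ∘ e := by
    funext j
    simp only [rowVec, Function.comp_apply, List.get_ofFn]
    rfl
  rw [h2]
  exact (linearIndependent_equiv e).mpr h

/-- Bits of `if c then a else 0`. -/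
theorem testBit_ite_zero (c : Bool) (a p : ℕ) : (if c then a else 0).testBit p = (c && a.testBit p) := by
  cases c <;> simp

/-- Pointwise Boolean identity behind the exchange of the `g`- and `α`-sums. -/
theorem key_bool (a b : Bool) (h f : ℕ → Bool) (Q : ℕ) :
    xor (a && b) (bxor (fun q => h q && (a && f q)) Q) = (a && xor b (bxor (fun q => h q && f q) Q)) := by
  cases a
  · simp only [Bool.false_and, Bool.and_false, Bool.false_xor]
    exact bxor_false' Q
  · simp only [Bool.true_and]

/-- `a && ·` distributes into a `bxor`. -/
theorem band_bxor (a : Bool) (f : ℕ → Bool) (s : ℕ) : (a && bxor f s) = bxor (fun j => a && f j) s := by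
  cases a
  · rw [Bool.false_and]; exact (bxor_false' s).symm
  · simp only [Bool.true_and]

/-! ## Affine row families: independence from separating functionals -/

section Affine

variable (r Q C : ℕ) (B : List ℕ) (Cs : List (List ℕ)) (ys : List ℕ)

/-- The row `i` at pattern `α`: `B_i ⊕ ⨁_{q : α_q = 1} C_{q,i}`. -/
def affRow (α i : ℕ) : ℕ :=
  B.getD i 0 ^^^ xorFold (fun q => if α.testBit q then (Cs.getD q []).getD i 0 else 0) Q

/-- The `g`-combination `⨁_{i : g_i = 1} L_i` of a list of rows. -/
def gcomb (L : List ℕ) (g : ℕ) : ℕ := xorFold (fun i => if g.testBit i then L.getD i 0 else 0) r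

/-- The functional certificate: data below `2^C`, and for every nonzero `g` a functional `y = ys[g]` with
`y·(gB) = 1` and `y·(gC_q) = 0` for all `q < Q`. -/
def funcCertB : Bool :=
  B.all (· < 2 ^ C) && Cs.all (fun L => L.all (· < 2 ^ C)) &&
  allLT (fun g => g == 0 || (bdot C (ys.getD g 0) (gcomb r B g) &&
    allLT (fun q => !bdot C (ys.getD g 0) (gcomb r (Cs.getD q []) g)) Q)) (2 ^ r)

variable {r Q C B Cs ys}

/-- The `g`-combination of the rows at `α` is `gB ⊕ ⨁_{q : α_q = 1} gC_q` (bitwise). -/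
theorem testBit_gcomb_affRow (g α p : ℕ) :
    (xorFold (fun i => if g.testBit i then affRow Q B Cs α i else 0) r).testBit p =
      (gcomb r B g ^^^ xorFold (fun q => if α.testBit q then gcomb r (Cs.getD q []) g else 0) Q).testBit p := by
  simp only [gcomb, affRow, testBit_xorFold, testBit_ite_zero, Nat.testBit_xor, band_bxor]
  rw [← bxor_comm2 (fun q i => α.testBit q && (g.testBit i && ((Cs.getD q []).getD i 0).testBit p)) Q r,
    ← bxor_xor]
  exact bxor_congr fun i _ => (key_bool _ _ _ _ Q).symm

/-- The rows are below `2 ^ C` when the data are. -/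
theorem affRow_lt (hB : ∀ b ∈ B, b < 2 ^ C) (hC : ∀ L ∈ Cs, ∀ c ∈ L, c < 2 ^ C) (α i : ℕ) :
    affRow Q B Cs α i < 2 ^ C := by
  have hget : ∀ (L : List ℕ), (∀ c ∈ L, c < 2 ^ C) → ∀ i, L.getD i 0 < 2 ^ C := by
    intro L hL i
    rw [List.getD_eq_getElem?_getD]
    cases h : L[i]? with
    | none => simp
    | some v => simpa using hL v (List.mem_of_getElem? h)
  refine Nat.xor_lt_two_pow (hget B hB i) (xorFold_lt _ (fun q => ?_) Q)
  split
  · by_cases hq : q < Cs.length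
    · rw [List.getD_eq_getElem _ _ hq]; exact hget _ (hC _ (List.getElem_mem hq)) i
    · rw [List.getD_eq_default _ _ (not_lt.mp hq)]; simp
  · exact Nat.two_pow_pos C

/-- **Independence from separating functionals**: for every pattern `α`, the rows `affRow α i` (`i < r`) are
linearly independent over `𝔽₂`. -/
theorem linearIndependent_affRow (h : funcCertB r Q C B Cs ys = true) (α : ℕ) :
    LinearIndependent (ZMod 2) (fun i : Fin r => vecOf C (affRow Q B Cs α i)) := by
  classical
  simp only [funcCertB, Bool.and_eq_true, List.all_eq_true, decide_eq_true_eq] at h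
  obtain ⟨⟨hB, hC⟩, hcert⟩ := h
  rw [allLT_iff] at hcert
  rw [Fintype.linearIndependent_iff]
  intro c hc
  -- encode the coefficients as a bit pattern `g`
  rw [← vecOf_bitsOfVec c] at hc ⊢
  set g := bitsOfVec c
  have hg : g < 2 ^ r := bitsOfVec_lt c
  by_cases hg0 : g = 0
  · intro i; simp [hg0, vecOf]
  exfalso
  have h1 := hcert g hg
  simp only [hg0, Bool.or_eq_true, beq_iff_eq, false_or, Bool.and_eq_true, allLT_iff,
    Bool.not_eq_true'] at h1
  obtain ⟨hyB, hyC⟩ := h1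
  -- the `g`-combination of the rows at `α`, as a number
  let X := xorFold (fun i => if g.testBit i then affRow Q B Cs α i else 0) r
  have hXbit : ∀ t : Fin C, X.testBit t = false := by
    intro t
    have := congrFun hc t
    rw [Finset.sum_apply, Pi.zero_apply] at this
    have e : ∀ i : Fin r, (vecOf r g i • vecOf C (affRow Q B Cs α i)) t
        = if (g.testBit i && (affRow Q B Cs α i).testBit t) then 1 else 0 := by
      intro i; simp only [Pi.smul_apply, vecOf, smul_eq_mul, ite_mul_ite]
    rw [Finset.sum_congr rfl (fun i _ => e i), Fin.sum_univ_eq_sum_range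
      (fun i => if (g.testBit i && (affRow Q B Cs α i).testBit t) then (1 : ZMod 2) else 0),
      sum_ite_range] at this
    have hb : bxor (fun i => g.testBit i && (affRow Q B Cs α i).testBit t) r = false := by
      by_contra hne; rw [Bool.not_eq_false] at hne; rw [hne] at this; exact one_ne_zero this
    rw [testBit_xorFold]
    rw [← hb]
    exact bxor_congr fun i _ => by split <;> simp_all
  have hXlt : X < 2 ^ C := xorFold_lt _ (fun i => by
    split
    · exact affRow_lt hB hC α i
    · exact Nat.two_pow_pos C) r
  have hX0 : X = 0 := by
    apply Nat.eq_of_testBit_eq; intro t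
    rw [Nat.zero_testBit]
    by_cases ht : t < C
    · exact hXbit ⟨t, ht⟩
    · exact Nat.testBit_lt_two_pow (lt_of_lt_of_le hXlt (Nat.pow_le_pow_right (by norm_num) (not_lt.mp ht)))
  -- apply the functional `y`
  set y := ys.getD g 0
  have hyX : bdot C y X = xor true (bxor (fun q => α.testBit q && bdot C y (gcomb r (Cs.getD q []) g)) Q) := by
    have eX : X = gcomb r B g ^^^ xorFold (fun q => if α.testBit q then gcomb r (Cs.getD q []) g else 0) Q :=
      Nat.eq_of_testBit_eq fun p => testBit_gcomb_affRow g α p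
    rw [eX, bdot_xor, hyB, bdot_xorFold]
    congr 1
    apply bxor_congr; intro q _
    by_cases hq : α.testBit q = true
    · simp [hq]
    · rw [Bool.not_eq_true] at hq; simp [hq, bdot_zero]
  rw [hX0, bdot_zero] at hyX
  have hz : bxor (fun q => α.testBit q && bdot C y (gcomb r (Cs.getD q []) g)) Q = false := by
    rw [← bxor_false' Q]
    apply bxor_congr; intro q hq
    rw [hyC q hq, Bool.and_false]
  rw [hz] at hyX
  exact Bool.false_ne_true hyX

end Affine

/-! ## The residual rows are affine in `α` -/

section Residual

open Literature.Computability.AlgebraicComplexity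

variable (m n : ℕ) (ts ws cs xs : List ℕ)

/-- `A_j(x, c') = a_j(x) (w_j)_{c'}` as a bit. -/
def aBit (x c' j : ℕ) : Bool := tbit m n x (ts.getD j 0) (cs.getD j 0) && (ws.getD j 0).testBit c'

/-- The `α`-independent part of a residual entry. -/
def baseBit (x b c' : ℕ) : Bool :=
  xor (tbit m n x b c') (bxor (fun j => aBit m n ts ws cs x c' j && (ts.contains b && ts.getD j 0 == b)) ts.length)

/-- The `α`-independent part of the residual row `c'`. -/
def baseRowD (c' : ℕ) : ℕ :=
  maskOf (fun t => baseBit m n ts ws cs (xs.getD (t / (m * n)) 0) (t % (m * n)) c') (xs.length * (m * n))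

/-- The coefficient row of `α_q` in the residual row `c'`. -/
def cqRowD (R : ℕ) (ri : List ℕ) (q c' : ℕ) : ℕ :=
  maskOf (fun t => bxor (fun j => aBit m n ts ws cs (xs.getD (t / (m * n)) 0) c' j &&
    (!ts.contains (t % (m * n)) && (j * R + ri.getD (t % (m * n)) 0 == q))) ts.length) (xs.length * (m * n))

variable {m n ts ws cs xs}

/-- `xorFold` depends only on the values below the bound. -/
theorem xorFold_congr {f g : ℕ → ℕ} : ∀ {Q}, (∀ q < Q, f q = g q) → xorFold f Q = xorFold g Q
  | 0, _ => rfl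
  | Q + 1, h => by
    rw [xorFold, xorFold, xorFold_congr (Q := Q) fun q hq => h q (Nat.lt_succ_of_lt hq), h Q (Nat.lt_succ_self Q)]

/-- Normal form of the right-hand side (exchange of the `j`- and `q`-sums). -/
theorem rhs_normal (A e : ℕ → Bool) (c : Bool) (a : ℕ → Bool) (qf : ℕ → ℕ) (s Q : ℕ) :
    xor (bxor (fun j => A j && (c && e j)) s)
      (bxor (fun q => a q && bxor (fun j => A j && (!c && (qf j == q))) s) Q)
    = bxor (fun j => A j && (if c then e j else (decide (qf j < Q) && a (qf j)))) s := by
  simp only [band_bxor]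
  rw [← bxor_comm2 (fun q j => a q && (A j && (!c && (qf j == q)))) Q s, ← bxor_xor]
  apply bxor_congr; intro j _
  have e1 : bxor (fun q => a q && (A j && (!c && (qf j == q)))) Q
      = (A j && !c && bxor (fun q => a q && (qf j == q)) Q) := by
    rw [band_bxor]; apply bxor_congr; intro q _
    cases a q <;> cases A j <;> cases c <;> simp
  rw [e1, bxor_indicator]
  cases A j <;> cases c <;> cases e j <;> simp

/-- **The residual rows are affine in `α`** (for `α < 2^Q`): `resRow1 α c' = baseRowD c' ⊕ ⨁_{α_q = 1} cqRowD q c'`. -/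
theorem resRow1_eq_affine (R : ℕ) (ri : List ℕ) {Q α : ℕ} (hα : α < 2 ^ Q) (c' : ℕ) :
    resRow1 m n ts ws cs xs R ri α c' =
      baseRowD m n ts ws cs xs c' ^^^ xorFold (fun q => if α.testBit q then cqRowD m n ts ws cs xs R ri q c' else 0) Q := by
  apply Nat.eq_of_testBit_eq; intro p
  rw [Nat.testBit_xor, testBit_xorFold]
  simp only [resRow1, baseRowD, cqRowD, testBit_maskOf, testBit_ite_zero]
  by_cases hp : p < xs.length * (m * n)
  · simp only [hp, decide_true, Bool.true_and, resBit, baseBit]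
    have hccj : ∀ j, ccBit ts R ri α j (p % (m * n)) = (if ts.contains (p % (m * n)) then
        ts.getD j 0 == p % (m * n) else (decide (j * R + ri.getD (p % (m * n)) 0 < Q) &&
          α.testBit (j * R + ri.getD (p % (m * n)) 0))) := by
      intro j
      simp only [ccBit]
      split
      · rfl
      · by_cases hq : j * R + ri.getD (p % (m * n)) 0 < Q
        · rw [decide_eq_true hq, Bool.true_and]
        · simp only [hq, decide_false, Bool.false_and]
          exact Nat.testBit_lt_two_pow (lt_of_lt_of_le hα (Nat.pow_le_pow_right (by norm_num) (not_lt.mp hq)))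
    rw [Bool.xor_assoc, rhs_normal]
    congr 1
    apply bxor_congr; intro j _
    rw [hccj, aBit]
  · simp only [hp, decide_false, Bool.false_and, Bool.false_xor, Bool.and_false]
    exact (bxor_false' Q).symm

/-- **Residual obligations from a functional certificate.** With `B`, `Cs` the precomputed base and
coefficient rows of the selected residual rows (equalities checked by `decide`/`rfl` in the data file) and a
certified table `ys` of separating functionals, every pattern `α` gives independent rows. -/
theorem residualsOK_of_funcCert {sel : List ℕ} (B : List ℕ) (Cs : List (List ℕ)) (ys : List ℕ)
    (hB : B = sel.map (baseRowD m n ts ws cs xs))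
    (hCs : Cs = (List.range (ts.length * (restL m n ts).length)).map fun q =>
      sel.map (cqRowD m n ts ws cs xs (restL m n ts).length (riOf m n ts) q))
    (h : funcCertB sel.length (ts.length * (restL m n ts).length) (xs.length * (m * n)) B Cs ys = true) :
    ResidualsOK m n ts ws cs xs sel := by
  intro α hα
  set Q := ts.length * (restL m n ts).length
  have hLI := linearIndependent_affRow h α
  have e : (fun i : Fin sel.length => vecOf (xs.length * (m * n))
      (resRow1 m n ts ws cs xs (restL m n ts).length (riOf m n ts) α (sel.getD i 0)))
      = fun i : Fin sel.length => vecOf (xs.length * (m * n)) (affRow Q B Cs α i) := by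
    funext i
    have hBi : B.getD i 0 = baseRowD m n ts ws cs xs (sel.getD i 0) := by
      subst hB
      simp [List.getD_eq_getElem?_getD]
    have hCi : ∀ q < Q, (Cs.getD q []).getD i 0
        = cqRowD m n ts ws cs xs (restL m n ts).length (riOf m n ts) q (sel.getD i 0) := by
      intro q hq
      subst hCs
      simp [List.getD_eq_getElem?_getD, List.getElem?_map, List.getElem?_range hq]
    have hx : xorFold (fun q => if α.testBit q then
          cqRowD m n ts ws cs xs (restL m n ts).length (riOf m n ts) q (sel.getD i 0) else 0) Q
        = xorFold (fun q => if α.testBit q then (Cs.getD q []).getD i 0 else 0) Q :=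
      xorFold_congr fun q hq => by rw [hCi q hq]
    rw [resRow1_eq_affine _ _ hα, affRow, hBi, hx]
  rw [← e] at hLI
  rw [← ofFn_getD_map]
  exact indepB_ofFn_of_linearIndependent _ hLI

end Residual

end Summit.MatrixMultiplication.OmegaCensus.GF2RankLB
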